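import Literature.NumberTheory.EllipticCurves.HeegnerPointsKolyvaginLocalCriterion
import Literature.NumberTheory.GaloisRepresentations.ContinuousH1ResCocycle
import Literature.NumberTheory.GaloisRepresentations.FrobeniusGeneration
import Literature.NumberTheory.GaloisRepresentations.IntegralGaloisActionProofs
import Literature.NumberTheory.GaloisRepresentations.RamificationFiltrationProofs
import Literature.NumberTheory.GaloisRepresentations.LocalGlobalCohomology
import HarnessLib

/-!
# Howard 2004, Lemma 1.6.2 — «evaluation at the Frobenius of the prime of `K` above `ℓ`»: the
# localization of an unramified class vanishes iff its cocycle vanishes at a Frobenius (abstract module)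

Topic `NumberTheory/GaloisCohomology/Howard2004` (second input of Howard's Lemma 1.6.2, itself
the first input of Lemma 1.6.4 = the residual Galois input of the print leaf G87
`Howard2004.thm161_dvrKolyvaginBound`; cell `pub/bsd-print-x9`, seat `bsd-line-x10b-p1-w6` g8;
sequel to `ChebotarevInertPrimesProofs`).  THEOREMS ONLY: no definition, no named fact, no
instance, no notation, no `sorry`.

Printed source.  B. Howard, *The Heegner point Kolyvagin system*, Compositio Math. **140**
(2004) = arXiv:1202.6340, Lemma 1.6.2 (arXiv Lemma 2.6.2, p. 11 L55–58): «For such an `ℓ`, the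
image of `c^±` under `H¹(K,T̄) → H¹(K_ℓ,T̄) → H¹_unr(K_ℓ,T̄) ≅ T̄` (the final isomorphism being
evaluation at the Frobenius of the prime of `K` above `ℓ`) is equal to `c^±(η) ≠ 0`.»  The same
local criterion is Gross 1991 Prop. 9.6 / McCallum 1991 (3) («`c_λ = 0 ⟺ φ_{Frob(λ)}(c) = 0`»),
proved in the tree for the classes of an elliptic curve (`E(K̄_v)[n]` versus `E(K̄)[n]`:
`WeierstrassCurve.mem_torsionLocalKer_iff_h1Eval_eq_zero`).

What is here: the criterion for an ARBITRARY discrete Galois module `ρ : Γ_K → Aut(M)` with `M`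
finite (e.g. Howard's residual representation `T̄` of a `DVRSetting`), where the localization
`H¹(K, M) → H¹(K_w, M)` is the tree's `galoisCohomology.localization ρ (Sum.inr w) 1` (restriction
along `Γ_{K_w} → Γ_K` for the chosen embedding `K̄ → K̄_w`), in the cocycle currency
`contOneCocycles` / `oneCocycleClass` of `ContinuousH1.lean`:

* §1 cocycle bookkeeping on elements acting trivially (`apply_mul_eq_add_of_apply_eq_self`,
  `apply_pow_eq_zero_of_apply_eq_zero`, `apply_conj_eq_of_forall_apply_eq_self`);
* §2 **`localization_oneCocycleClass_eq_zero_iff_of_primeBelow`** — at the prime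
  `𝔓 = 𝔓_{ι,𝔐}` of `\bar ℤ_K` cut out by the embedding: if `F ∈ Γ_K` is an arithmetic Frobenius
  at `𝔓` acting trivially on `M`, the inertia group `I_𝔓` acts trivially on `M` and the cocycle
  `φ` vanishes on `I_𝔓` (the class is unramified), then `loc_w [φ] = 0 ↔ φ(F) = 0`;
* §3 **`localization_oneCocycleClass_eq_zero_iff`** — the same at ANY prime `𝔔 ∣ w` of `\bar ℤ_K`
  (primes above `w` are conjugate, `exists_smul_eq_of_mem_primesAbove_holds`; the hypotheses and
  the value `φ(F)` transform by `δ`), the shape produced by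
  `exists_inert_prime_isArithFrobAt_conjGal_mul` of `ChebotarevInertPrimesProofs`.

Proof (Gross/McCallum, as in the tree's elliptic-curve file): (⟹) the local–global principle for
decomposition groups (`exists_apply_eq_smul_of_mem_decompositionSubgroup`) lifts `F` to
`Γ_{K_w}`, where the restricted cocycle is a coboundary `g ↦ g v − v`, which vanishes at `F`;
(⟸) every element of the decomposition group is `Fⁿ · i · u` with `i ∈ I_𝔓` and `u` in the open
subgroup of `ker ρ` where `φ` vanishes (`exists_eq_frobenius_pow_mul_of_mem_decompositionSubgroup`),
and the restriction of `Γ_{K_w}` lands in the decomposition group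
(`resGalOfEmb_mem_decompositionSubgroup`), so the restricted cocycle is identically zero.

HONEST FRAMING.  Not Lemma 1.6.2 (the `τ`-eigenspace argument from H.1/H.5(a) remains), not
Lemma 1.6.4, not Thm. 1.6.1; no summit statement is proved; the Birch–Swinnerton-Dyer conjecture
is not proved by any of this.

References: [Howard2004HeegnerKolyvagin] Lemma 1.6.2 (arXiv 2.6.2, p. 11 L55–58);
[GrossLMS1991] §9 Prop. 9.6; [McCallumLMS1991] §3 (3); [NeukirchANT1999] I §9 (9.4)–(9.6),
II §9 (9.6); [SerreGaloisCohomology1997] I §2.4, §5.1.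
-/

set_option autoImplicit false

noncomputable section

open scoped Classical Pointwise
open Function NumberField IsDedekindDomain Field

universe u

namespace Literature.NumberTheory.GaloisCohomology.Howard2004

open Literature.NumberTheory.GaloisRepresentations
open Literature.NumberTheory.EllipticCurves

/-! ## §1 Cocycle bookkeeping on elements acting trivially -/

section Cocycles

variable {K : Type u} [Field K] {M : Type u} [AddCommGroup M] [TopologicalSpace M]
  [DiscreteTopology M] (ρ : DiscreteGaloisModule K M) (φ : contOneCocycles ρ.toTopRep)

/-- `φ(g h) = φ(g) + φ(h)` when `g` acts trivially (the crossed-homomorphism identity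
`φ(gh) = φ(g) + g φ(h)`). [cite: SerreGaloisCohomology1997, I §5.1] -/
theorem apply_mul_eq_add_of_apply_eq_self {g : absoluteGaloisGroup K} (hg : ∀ m, ρ g m = m)
    (h : absoluteGaloisGroup K) : φ.1 (g * h) = φ.1 g + φ.1 h := by
  rw [φ.2 g h]
  exact congrArg (φ.1 g + ·) (hg _)

omit [TopologicalSpace M] [DiscreteTopology M] in
/-- Powers of an element acting trivially act trivially. [folklore] -/
private theorem forall_apply_pow_eq_self (ρ' : Representation ℤ (absoluteGaloisGroup K) M)
    {g : absoluteGaloisGroup K} (hg : ∀ m, ρ' g m = m) (n : ℕ) : ∀ m, ρ' (g ^ n) m = m := by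
  induction n with
  | zero => intro m; rw [pow_zero, map_one, Module.End.one_apply]
  | succ n ih => intro m; rw [pow_succ, map_mul, Module.End.mul_apply, hg, ih]

/-- `φ(gⁿ) = 0` when `g` acts trivially and `φ(g) = 0`. [cite: SerreGaloisCohomology1997, I §5.1] -/
theorem apply_pow_eq_zero_of_apply_eq_zero {g : absoluteGaloisGroup K} (hg : ∀ m, ρ g m = m)
    (hφ : φ.1 g = 0) (n : ℕ) : φ.1 (g ^ n) = 0 := by
  induction n with
  | zero => rw [pow_zero]; exact contOneCocycles.apply_one φ
  | succ n ih =>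
    rw [pow_succ, apply_mul_eq_add_of_apply_eq_self ρ φ
      (forall_apply_pow_eq_self ρ.toRepresentation hg n) g, ih, hφ, add_zero]

/-- `φ(δ g δ⁻¹) = δ · φ(g)` when `g` acts trivially. [cite: SerreGaloisCohomology1997, I §5.1] -/
theorem apply_conj_eq_of_forall_apply_eq_self {g : absoluteGaloisGroup K} (hg : ∀ m, ρ g m = m)
    (δ : absoluteGaloisGroup K) : φ.1 (δ * g * δ⁻¹) = ρ δ (φ.1 g) := by
  have h1 : φ.1 (δ * g * δ⁻¹) = φ.1 δ + ρ δ (φ.1 g + φ.1 δ⁻¹) := by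
    rw [mul_assoc, φ.2 δ (g * δ⁻¹), apply_mul_eq_add_of_apply_eq_self ρ φ hg]
    rfl
  have h2 : φ.1 δ + ρ δ (φ.1 δ⁻¹) = 0 := by
    have h := φ.2 δ δ⁻¹
    rw [mul_inv_cancel, contOneCocycles.apply_one] at h
    exact h.symm
  rw [h1, map_add, ← add_assoc, add_comm (φ.1 δ), add_assoc, h2, add_zero]

end Cocycles

/-! ## §2 The criterion at the prime cut out by the embedding `K̄ → K̄_w` -/

section PrimeBelow

variable {K : Type u} [Field K] [NumberField K] {M : Type u} [AddCommGroup M] [TopologicalSpace M]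
  [DiscreteTopology M] [Finite M]

/-- **«Evaluation at the Frobenius», at the prime `𝔓_{ι,𝔐}` cut out by the chosen embedding
`ι : K̄ → K̄_w`** (Howard Lemma 1.6.2 / Gross Prop. 9.6 / McCallum (3), abstract module).  Let
`ρ` be a discrete `Γ_K`-module with `M` finite, `w` a finite place of `K`, `𝔐` a prime of
`\bar 𝓞_w` above `𝓂_w` and `𝔓 = w.primeBelow ι 𝔐`.  If `F ∈ Γ_K` is an arithmetic Frobenius at
`𝔓` acting trivially on `M`, the inertia group `I_𝔓` acts trivially on `M`, and the continuous
crossed homomorphism `φ : Γ_K → M` vanishes on `I_𝔓` (its class is unramified at `𝔓`), then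
**`loc_w [φ] = 0` in `H¹(K_w, M)` iff `φ(F) = 0`**.
[cite: Howard2004HeegnerKolyvagin, Lemma 1.6.2 (arXiv:1202.6340 Lemma 2.6.2, p. 11 L55–58)]
[cite: GrossLMS1991, Prop. 9.6] -/
theorem localization_oneCocycleClass_eq_zero_iff_of_primeBelow (ρ : DiscreteGaloisModule K M)
    (φ : contOneCocycles ρ.toTopRep) {w : HeightOneSpectrum (𝓞 K)}
    {𝔐 : Ideal (HeightOneSpectrum.localAbsIntegers w)} (h𝔐 : 𝔐 ∈ w.localPrimesAbove)
    {F : absoluteGaloisGroup K}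
    (hF : IsArithFrobAt (𝓞 K) F (w.primeBelow (closureEmb (K := K) (w.adicCompletion K)) 𝔐))
    (hFρ : ∀ m, ρ F m = m)
    (hI : ∀ i ∈ (w.primeBelow (closureEmb (K := K) (w.adicCompletion K)) 𝔐).inertia
      (absoluteGaloisGroup K), ∀ m, ρ i m = m)
    (hφI : ∀ i ∈ (w.primeBelow (closureEmb (K := K) (w.adicCompletion K)) 𝔐).inertia
      (absoluteGaloisGroup K), φ.1 i = 0) :
    galoisCohomology.localization ρ (Sum.inr w) 1 (oneCocycleClass ρ.toTopRep φ) = 0 ↔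
      φ.1 F = 0 := by
  set ι₀ := closureEmb (K := K) (w.adicCompletion K) with hι₀
  set 𝔓 := w.primeBelow ι₀ 𝔐 with h𝔓def
  have h𝔓 : 𝔓 ∈ w.primesAbove := HeightOneSpectrum.primeBelow_mem_primesAbove h𝔐
  haveI : 𝔓.IsPrime := h𝔓.1
  -- the localization on the cocycle: `loc [φ] = 0 ↔ φ ∘ res` is principal on `Γ_{K_w}`
  have hloc : galoisCohomology.localization ρ (Sum.inr w) 1 (oneCocycleClass ρ.toTopRep φ) = 0 ↔
      ∃ v : M, ∀ g : absoluteGaloisGroup (w.adicCompletion K),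
        φ.1 (absGaloisRestrict K (w.adicCompletion K) g) =
          ρ (absGaloisRestrict K (w.adicCompletion K) g) v - v := by
    change galoisCohomology.res ρ (w.adicCompletion K) 1 (oneCocycleClass ρ.toTopRep φ) = 0 ↔ _
    rw [galoisCohomology.res_oneCocycleClass]
    exact oneCocycleClass_eq_zero_iff _ _
  -- the restriction of `Γ_{K_w}` lands in the decomposition group of `𝔓`
  have hres : ∀ g : absoluteGaloisGroup (w.adicCompletion K),
      absGaloisRestrict K (w.adicCompletion K) g ∈ 𝔓.decompositionSubgroup (absoluteGaloisGroup K) := by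
    intro g
    exact resGalOfEmb_mem_decompositionSubgroup ι₀ h𝔐 g
  constructor
  · -- `loc = 0 ⟹ φ(F) = 0`: lift `F` to `Γ_{K_w}`
    intro h0
    obtain ⟨v, hv⟩ := hloc.mp h0
    obtain ⟨σ, hσ⟩ := exists_apply_eq_smul_of_mem_decompositionSubgroup ι₀ h𝔐 hF.mem_stabilizer
    have hresσ : absGaloisRestrict K (w.adicCompletion K) σ = F :=
      resGalOfEmb_eq_of_apply_eq ι₀ hσ
    have h := hv σ
    rw [hresσ, hFρ, sub_self] at h
    exact h
  · -- `φ(F) = 0 ⟹ loc = 0`: `φ` vanishes on the decomposition group `⟨F⟩ · I_𝔓 · U`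
    intro hval
    refine hloc.mpr ⟨0, fun g ↦ ?_⟩
    rw [map_zero, sub_zero]
    -- the open subgroup `U = {u | u acts trivially and φ u = 0}`
    let U : Subgroup (absoluteGaloisGroup K) :=
      { carrier := {u | (∀ m, ρ u m = m) ∧ φ.1 u = 0}
        mul_mem' := fun {a b} ha hb ↦ ⟨fun m ↦ by rw [map_mul, Module.End.mul_apply, hb.1, ha.1],
          by rw [apply_mul_eq_add_of_apply_eq_self ρ φ ha.1, ha.2, hb.2, add_zero]⟩
        one_mem' := ⟨fun m ↦ by rw [map_one, Module.End.one_apply], contOneCocycles.apply_one φ⟩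
        inv_mem' := fun {a} ha ↦ by
          have hinv : ∀ m, ρ a⁻¹ m = m := fun m ↦ by
            conv_lhs => rw [← ha.1 m]
            rw [← Module.End.mul_apply, ← map_mul, inv_mul_cancel, map_one, Module.End.one_apply]
          refine ⟨hinv, ?_⟩
          have h := φ.2 a a⁻¹
          rw [mul_inv_cancel, contOneCocycles.apply_one, ha.2, zero_add] at h
          have h' : ρ a (φ.1 a⁻¹) = 0 := h.symm
          have h'' := congrArg (ρ a⁻¹) h'
          rwa [← Module.End.mul_apply, ← map_mul, inv_mul_cancel, map_one, Module.End.one_apply,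
            map_zero] at h'' }
    have hUopen : IsOpen (U : Set (absoluteGaloisGroup K)) := by
      have h1 : IsOpen {u : absoluteGaloisGroup K | ∀ m, ρ u m = m} := by
        rw [Set.setOf_forall]
        exact isOpen_iInter_of_finite fun m ↦ ρ.isOpen_setOf_apply_eq m
      have h2 : IsOpen {u : absoluteGaloisGroup K | φ.1 u = 0} :=
        (isOpen_discrete {(0 : M)}).preimage φ.1.continuous
      exact h1.inter h2
    obtain ⟨n, i, u, hi, hu, hdec⟩ :=
      exists_eq_frobenius_pow_mul_of_mem_decompositionSubgroup h𝔓 hF hUopen (hres g)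
    have hFn : ∀ m, ρ (F ^ n) m = m := forall_apply_pow_eq_self ρ.toRepresentation hFρ n
    rw [hdec, apply_mul_eq_add_of_apply_eq_self ρ φ (g := F ^ n * i) (fun m ↦ by
        rw [map_mul, Module.End.mul_apply, hI i hi, hFn]) u,
      apply_mul_eq_add_of_apply_eq_self ρ φ hFn i, apply_pow_eq_zero_of_apply_eq_zero ρ φ hFρ hval,
      hφI i hi, hu.2, add_zero, add_zero]

end PrimeBelow

/-! ## §3 The criterion at any prime of `\bar ℤ_K` above `w` -/

section AnyPrime

variable {K : Type u} [Field K] [NumberField K] {M : Type u} [AddCommGroup M] [TopologicalSpace M]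
  [DiscreteTopology M] [Finite M]

/-- **«Evaluation at the Frobenius of the prime of `K` above `ℓ`» at ANY prime `𝔔 ∣ w` of
`\bar ℤ_K`** (Howard Lemma 1.6.2 / Gross Prop. 9.6 / McCallum (3), abstract module): for `ρ` a
discrete `Γ_K`-module with `M` finite, `w` a finite place, `𝔔 ∈ w.primesAbove`, `F ∈ Γ_K` an
arithmetic Frobenius at `𝔔` acting trivially on `M`, the inertia group `I_𝔔` acting trivially on
`M`, and `φ : Γ_K → M` a continuous crossed homomorphism vanishing on `I_𝔔`:
**`loc_w [φ] = 0` in `H¹(K_w, M)` iff `φ(F) = 0`**.  (Reduction to §2: `𝔔 = δ • 𝔓_{ι,𝔐}` for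
some `δ ∈ Γ_K` — `exists_smul_eq_of_mem_primesAbove_holds` — and `δ⁻¹ F δ` is a Frobenius at
`𝔓_{ι,𝔐}` with `φ(F) = δ · φ(δ⁻¹ F δ)`.)  This is the shape fed by
`exists_inert_prime_isArithFrobAt_conjGal_mul` (`∃ 𝔔 ∈ w.primesAbove, IsArithFrobAt … 𝔔`).
[cite: Howard2004HeegnerKolyvagin, Lemma 1.6.2 (arXiv:1202.6340 Lemma 2.6.2, p. 11 L55–58)]
[cite: McCallumLMS1991, §3 (3)] -/
theorem localization_oneCocycleClass_eq_zero_iff (ρ : DiscreteGaloisModule K M)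
    (φ : contOneCocycles ρ.toTopRep) {w : HeightOneSpectrum (𝓞 K)}
    {𝔔 : Ideal (absIntegers (𝓞 K) K)} (h𝔔 : 𝔔 ∈ w.primesAbove) {F : absoluteGaloisGroup K}
    (hF : IsArithFrobAt (𝓞 K) F 𝔔) (hFρ : ∀ m, ρ F m = m)
    (hI : ∀ i ∈ 𝔔.inertia (absoluteGaloisGroup K), ∀ m, ρ i m = m)
    (hφI : ∀ i ∈ 𝔔.inertia (absoluteGaloisGroup K), φ.1 i = 0) :
    galoisCohomology.localization ρ (Sum.inr w) 1 (oneCocycleClass ρ.toTopRep φ) = 0 ↔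
      φ.1 F = 0 := by
  obtain ⟨𝔐, h𝔐⟩ := w.localPrimesAbove_nonempty
  set ι₀ := closureEmb (K := K) (w.adicCompletion K) with hι₀
  set 𝔓 := w.primeBelow ι₀ 𝔐 with h𝔓def
  have h𝔓 : 𝔓 ∈ w.primesAbove := HeightOneSpectrum.primeBelow_mem_primesAbove h𝔐
  haveI : 𝔓.IsPrime := h𝔓.1
  haveI : 𝔔.IsPrime := h𝔔.1
  -- `𝔓 = δ • 𝔔`; `F' = δ F δ⁻¹` is a Frobenius at `𝔓`
  obtain ⟨δ, hδ⟩ := HeightOneSpectrum.exists_smul_eq_of_mem_primesAbove_holds h𝔔 h𝔓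
  have hF' : IsArithFrobAt (𝓞 K) (δ * F * δ⁻¹) 𝔓 := by
    have h := hF.conj δ
    rwa [hδ] at h
  -- conjugation bookkeeping for the action
  have hconjρ : ∀ {g : absoluteGaloisGroup K}, (∀ m, ρ g m = m) → ∀ (ε : absoluteGaloisGroup K) (m : M),
      ρ (ε * g * ε⁻¹) m = m := by
    intro g hg ε m
    have h := hg (ρ ε⁻¹ m)
    rw [map_mul, map_mul, Module.End.mul_apply, Module.End.mul_apply, h, ← Module.End.mul_apply,
      ← map_mul, mul_inv_cancel, map_one, Module.End.one_apply]
  have hF'ρ : ∀ m, ρ (δ * F * δ⁻¹) m = m := hconjρ hFρ δ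
  -- inertia: `I_𝔓 = δ I_𝔔 δ⁻¹`, so `δ⁻¹ i δ ∈ I_𝔔` for `i ∈ I_𝔓`
  have hImem : ∀ i ∈ 𝔓.inertia (absoluteGaloisGroup K),
      δ⁻¹ * i * δ ∈ 𝔔.inertia (absoluteGaloisGroup K) := by
    intro i hi
    rw [← hδ, Ideal.inertia_smul, Subgroup.mem_pointwise_smul_iff_inv_smul_mem, MulAut.smul_def,
      MulAut.conj_inv_apply] at hi
    exact hi
  have hI' : ∀ i ∈ 𝔓.inertia (absoluteGaloisGroup K), ∀ m, ρ i m = m := by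
    intro i hi
    have h := hconjρ (hI _ (hImem i hi)) δ
    rwa [show δ * (δ⁻¹ * i * δ) * δ⁻¹ = i by group] at h
  have hφI' : ∀ i ∈ 𝔓.inertia (absoluteGaloisGroup K), φ.1 i = 0 := by
    intro i hi
    have h := apply_conj_eq_of_forall_apply_eq_self ρ φ (hI _ (hImem i hi)) δ
    rw [show δ * (δ⁻¹ * i * δ) * δ⁻¹ = i by group, hφI _ (hImem i hi), map_zero] at h
    exact h
  rw [localization_oneCocycleClass_eq_zero_iff_of_primeBelow ρ φ h𝔐 hF' hF'ρ hI' hφI',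
    apply_conj_eq_of_forall_apply_eq_self ρ φ hFρ δ]
  -- `δ · φ(F) = 0 ↔ φ(F) = 0`
  constructor
  · intro h
    have h' := congrArg (ρ δ⁻¹) h
    rwa [← Module.End.mul_apply, ← map_mul, inv_mul_cancel, map_one, Module.End.one_apply,
      map_zero] at h'
  · intro h; rw [h, map_zero]

end AnyPrime

end Literature.NumberTheory.GaloisCohomology.Howard2004

end
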